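import Mathlib
import Summits.NavierStokesRegularity.NavierStokesRegularity.Theorems.WakeRatchetTailRatchetEternalGapVisc
import HarnessLib

/-!
# `WakeRatchet.TailRatchet` (stmt-NavierStokesRegularity-21808): the `ε₀⁻¹` AMPLITUDE FLOOR for
# BLOCK-DSS bounded eternal solutions with ANY covariant viscosity — every witness family of the
# registered kill criteria is large

Support file for the crux `TailRatchet` (route `WakeRatchet`; MODEL lattice ODEs of Tao 2016 §4 —
nothing in this file is a statement about the Navier–Stokes equations, and no item is closed here).

The kill criteria on record for the crux and its registered stubs (`tailRatchet_false_of_persistentDSSWaves`,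
`tailRatchet_false_of_persistent_blockDSS_visc`, `stub_rung_dss` with `W (n+1) σ = W n (σ − T)`) ask for
uniformly bounded admissible eternal solutions that are DISCRETELY SELF-SIMILAR modulo a block of `p`
shells: `W_{n+p}(σ) = W_n(σ − T')`.  For such a solution the shell actions `J_n = ∫‖W_n‖²` and
action-fluxes `I_n = ∫⟪W_{n+1}, A W_n⟫` are `p`-periodic in `n` (log-time translation invariance of the
integrals), so summing the shell balance `J_n (+ D_n) = Λ I_{n−1} − Λ⁻¹ I_n` of the companion files over
one block makes the two flux sums coincide up to the weights:
  `Σ_block J_n ≤ (Λ − Λ⁻¹) Σ_block I_n ≤ (Λ − Λ⁻¹)·fluxConst α·C · Σ_block J_n`.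
Hence (`blockDSS_eq_zero_of_small_bound`) `(Λ − Λ⁻¹)·fluxConst α·C < 1 ⇒ W ≡ 0`, for every `ν̂ ≥ 0`,
and on `R`-comparable tables with `0 < ε₀ ≤ 1` every non-trivial block-DSS bounded admissible eternal
solution has a shell value of norm `> 1/(896 ε₀)` (`blockDSS_exists_large`) — the type-I constant of
EVERY witness the registered kill criteria could use diverges like `ε₀⁻¹`, viscous or not (the inviscid
single-block case is the DSS amplitude floor of `WakeRatchetTailRatchetDSSAmplitudeFloor`; the
`ε₀`-uniform gap `1/576` of `WakeRatchetTailRatchetEternalGapVisc` needs no self-similarity).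

HONEST FRAMING: elementary real analysis on the cell's lemma layer; MODEL lattice only.
-/

noncomputable section

set_option linter.dupNamespace false

namespace Summit.NavierStokesRegularity.NavierStokesRegularity.Theorems

namespace WakeRatchetBlockDSSFloor

open MeasureTheory Set Filter Topology
open scoped RealInnerProductSpace
open Literature.Analysis.FluidPDE Literature.Analysis.FluidPDE.TaoCascade
open WakeRatchetEternalActionSummable WakeRatchetEternalGap WakeRatchetEternalGapVisc

variable {m : ℕ} {ε₀ νh : ℝ} {α : Fin m → Fin m → Fin m → ℤ × ℤ × ℤ → ℝ} {W : ℤ → ℝ → Em m}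

/-- **Shell balance as an inequality, any `ν̂ ≥ 0`** (`ε₀ > 0`):
`∫‖W_n‖² ≤ Λ ∫⟪W_n, A W_{n−1}⟫ − Λ⁻¹ ∫⟪W_{n+1}, A W_n⟫` (equality when `ν̂ = 0`; the dissipation
`D_n ≥ 0` is dropped when `ν̂ > 0`).
[cite: Tao2016AveragedNS, §4 (4.3), Lemma 4.1 (4.9)–(4.10), viscous equation before Thm. 4.2, §6.4; cell theorem] -/
theorem integral_norm_sq_le (hε : 0 < ε₀) (hW : IsEternalVisc ε₀ νh α W) (hc : IsCancellingCoeff α)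
    {C : ℝ} (hC : ∀ k σ, ‖W k σ‖ ≤ C) (n : ℤ) :
    ∫ σ, ‖W n σ‖ ^ 2 ≤ bigLam ε₀ * (∫ σ, ⟪W n σ, tableA α (W (n - 1) σ)⟫)
      - (bigLam ε₀)⁻¹ * ∫ σ, ⟪W (n + 1) σ, tableA α (W n σ)⟫ := by
  rcases hW.nonneg.lt_or_eq with hν | hν
  · have h := shell_balance_visc hε hν hW hc hC n
    have hD : 0 ≤ ∫ σ, viscCoef ε₀ νh n σ * ‖W n σ‖ ^ 2 :=
      integral_nonneg fun σ => by unfold viscCoef; positivity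
    linarith
  · have hW0 : IsEternal ε₀ α W := by
      rw [← isEternalVisc_zero_iff]; rw [hν]; exact hW
    exact (integral_norm_sq_eq hW0 hc hC n).le

/-- Block periodicity of the shell actions: `W_{n+p}(σ) = W_n(σ − T')` gives `∫‖W_{n+p}‖² = ∫‖W_n‖²`.
[cite: Tao2016AveragedNS, §6.4 (log-time translation); elementary] -/
theorem action_periodic {p : ℕ} {T' : ℝ} (hper : ∀ (n : ℤ) (σ : ℝ), W (n + p) σ = W n (σ - T'))
    (n : ℤ) : ∫ σ, ‖W (n + p) σ‖ ^ 2 = ∫ σ, ‖W n σ‖ ^ 2 := by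
  simp_rw [hper n]
  exact integral_sub_right_eq_self (fun σ => ‖W n σ‖ ^ 2) T'

/-- Block periodicity of the action-fluxes: `∫⟪W_{n+p+1}, A W_{n+p}⟫ = ∫⟪W_{n+1}, A W_n⟫`.
[cite: Tao2016AveragedNS, §6.4 (log-time translation); elementary] -/
theorem flux_periodic {p : ℕ} {T' : ℝ} (hper : ∀ (n : ℤ) (σ : ℝ), W (n + p) σ = W n (σ - T'))
    (n : ℤ) :
    ∫ σ, ⟪W (n + p + 1) σ, tableA α (W (n + p) σ)⟫ = ∫ σ, ⟪W (n + 1) σ, tableA α (W n σ)⟫ := by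
  have h1 : ∀ σ, W (n + p + 1) σ = W (n + 1) (σ - T') := by
    intro σ; rw [show n + (p : ℤ) + 1 = (n + 1) + p by ring]; exact hper (n + 1) σ
  simp_rw [h1, hper n]
  exact integral_sub_right_eq_self (fun σ => ⟪W (n + 1) σ, tableA α (W n σ)⟫) T'

/-- Cyclic-shift bookkeeping for a `p`-periodic sequence: `Σ_{k<p} I(a+1+k) = Σ_{k<p} I(a+k)`.
[folklore] -/
theorem sum_periodic_shift (I : ℤ → ℝ) {p : ℕ} (hI : ∀ n : ℤ, I (n + p) = I n) (a : ℤ) :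
    ∑ k ∈ Finset.range p, I (a + 1 + k) = ∑ k ∈ Finset.range p, I (a + k) := by
  have h := sum_shift_pred I (a + 1) p
  simp only [add_sub_cancel_right] at h
  have h2 : I (a + 1 + (p : ℤ) - 1) = I a := by
    rw [show a + 1 + (p : ℤ) - 1 = a + p by ring]; exact hI a
  rw [h2] at h
  linarith

/-- **No small block-DSS eternal solutions** (any `ν̂ ≥ 0`, `ε₀ > 0`): a uniformly bounded admissible
eternal solution of a cancelling table that is discretely self-similar modulo a block of `p ≥ 1` shells,
`W_{n+p}(σ) = W_n(σ − T')`, and whose uniform bound satisfies `(Λ − Λ⁻¹)·fluxConst α·C < 1`, vanishes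
identically. [cite: Tao2016AveragedNS, §4 (4.1)–(4.3), Lemma 4.1 (4.8)–(4.10), §6.4; cell theorem] -/
theorem blockDSS_eq_zero_of_small_bound (hε : 0 < ε₀) (hW : IsEternalVisc ε₀ νh α W)
    (hc : IsCancellingCoeff α) {C : ℝ} (hC : ∀ k σ, ‖W k σ‖ ≤ C) {p : ℕ} (hp : 0 < p) {T' : ℝ}
    (hper : ∀ (n : ℤ) (σ : ℝ), W (n + p) σ = W n (σ - T'))
    (hsmall : (bigLam ε₀ - (bigLam ε₀)⁻¹) * fluxConst α * C < 1) :
    ∀ (n : ℤ) (σ : ℝ), W n σ = 0 := by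
  have hΛ1 : 1 ≤ bigLam ε₀ := one_le_bigLam hε.le
  set I : ℤ → ℝ := fun n => ∫ σ, ⟪W (n + 1) σ, tableA α (W n σ)⟫ with hI
  set J : ℤ → ℝ := fun n => ∫ σ, ‖W n σ‖ ^ 2 with hJ
  have hJ0 : ∀ n, 0 ≤ J n := fun n => integral_nonneg fun σ => by positivity
  have hIp : ∀ n : ℤ, I (n + p) = I n := fun n => flux_periodic hper n
  have hJp : ∀ n : ℤ, J (n + p) = J n := fun n => action_periodic hper n
  have hbal : ∀ n : ℤ, J n ≤ bigLam ε₀ * I (n - 1) - (bigLam ε₀)⁻¹ * I n := by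
    intro n
    have h := integral_norm_sq_le hε hW hc hC n
    simp only [hI, hJ, sub_add_cancel]
    exact h
  have hIJ : ∀ n : ℤ, |I n| ≤ fluxConst α * C * J n := fun n => abs_integral_flux_le_visc hW hc hC n
  have hnn : 0 ≤ bigLam ε₀ - (bigLam ε₀)⁻¹ := by
    have : (bigLam ε₀)⁻¹ ≤ 1 := inv_le_one_of_one_le₀ hΛ1
    linarith
  -- one block `a+1, …, a+p`
  have hblock : ∀ a : ℤ, ∑ k ∈ Finset.range p, J (a + 1 + k) = 0 := by
    intro a
    set S := ∑ k ∈ Finset.range p, J (a + 1 + k) with hS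
    have hS0 : 0 ≤ S := Finset.sum_nonneg fun k _ => hJ0 _
    -- sum of the balances
    have h1 : S ≤ bigLam ε₀ * ∑ k ∈ Finset.range p, I (a + k)
        - (bigLam ε₀)⁻¹ * ∑ k ∈ Finset.range p, I (a + 1 + k) := by
      rw [hS, Finset.mul_sum, Finset.mul_sum, ← Finset.sum_sub_distrib]
      refine Finset.sum_le_sum fun k _ => ?_
      have h := hbal (a + 1 + k)
      rw [show a + 1 + (k : ℤ) - 1 = a + k by ring] at h
      exact h
    rw [sum_periodic_shift I hIp a] at h1
    have h2 : |∑ k ∈ Finset.range p, I (a + k)| ≤ fluxConst α * C * ∑ k ∈ Finset.range p, J (a + k) := by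
      calc |∑ k ∈ Finset.range p, I (a + k)| ≤ ∑ k ∈ Finset.range p, |I (a + k)| :=
            Finset.abs_sum_le_sum_abs _ _
        _ ≤ ∑ k ∈ Finset.range p, fluxConst α * C * J (a + k) :=
            Finset.sum_le_sum fun k _ => hIJ (a + k)
        _ = fluxConst α * C * ∑ k ∈ Finset.range p, J (a + k) := by rw [Finset.mul_sum]
    have h3 : ∑ k ∈ Finset.range p, J (a + k) = S := by
      rw [hS, sum_periodic_shift J hJp a]
    rw [h3] at h2
    have h4 : S ≤ (bigLam ε₀ - (bigLam ε₀)⁻¹) * (fluxConst α * C * S) := by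
      calc S ≤ (bigLam ε₀ - (bigLam ε₀)⁻¹) * ∑ k ∈ Finset.range p, I (a + k) := by linarith
        _ ≤ (bigLam ε₀ - (bigLam ε₀)⁻¹) * |∑ k ∈ Finset.range p, I (a + k)| :=
            mul_le_mul_of_nonneg_left (le_abs_self _) hnn
        _ ≤ (bigLam ε₀ - (bigLam ε₀)⁻¹) * (fluxConst α * C * S) :=
            mul_le_mul_of_nonneg_left h2 hnn
    by_contra hne
    have hpos : 0 < S := lt_of_le_of_ne hS0 (Ne.symm hne)
    have : (bigLam ε₀ - (bigLam ε₀)⁻¹) * (fluxConst α * C * S) < 1 * S := by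
      rw [show (bigLam ε₀ - (bigLam ε₀)⁻¹) * (fluxConst α * C * S)
        = ((bigLam ε₀ - (bigLam ε₀)⁻¹) * fluxConst α * C) * S by ring]
      exact mul_lt_mul_of_pos_right hsmall hpos
    linarith
  -- every shell action vanishes
  have hJzero : ∀ n : ℤ, J n = 0 := by
    intro n
    have h := hblock (n - 1)
    have hle : J n ≤ ∑ k ∈ Finset.range p, J (n - 1 + 1 + k) := by
      have hmem : (0 : ℕ) ∈ Finset.range p := Finset.mem_range.2 hp
      have := Finset.single_le_sum (f := fun k : ℕ => J (n - 1 + 1 + k)) (fun k _ => hJ0 _) hmem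
      simpa using this
    rw [h] at hle
    exact le_antisymm hle (hJ0 n)
  intro n σ
  have hE := integrable_norm_sq_visc hW hC n
  have hae : (fun σ => ‖W n σ‖ ^ 2) =ᵐ[volume] 0 :=
    (integral_eq_zero_iff_of_nonneg (fun σ => by positivity) hE).1 (hJzero n)
  have hcont : Continuous (fun σ => ‖W n σ‖ ^ 2) :=
    ((WakeRatchetOrthant.continuous_shell hW n).norm).pow 2
  have hzero := congrFun ((Continuous.ae_eq_iff_eq volume hcont continuous_const).1 hae) σ
  have h0 : ‖W n σ‖ ^ 2 = 0 := hzero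
  exact norm_eq_zero.1 ((pow_eq_zero_iff two_ne_zero).1 h0)

/-- **Amplitude floor for block-DSS eternal solutions** (contrapositive): a NON-TRIVIAL one has
`(Λ − Λ⁻¹)·fluxConst α·C ≥ 1` for every uniform bound `C`.
[cite: Tao2016AveragedNS, §4 (4.1)–(4.3), Lemma 4.1 (4.8)–(4.10), §6.4; cell theorem] -/
theorem blockDSS_one_le_of_ne_zero (hε : 0 < ε₀) (hW : IsEternalVisc ε₀ νh α W)
    (hc : IsCancellingCoeff α) {C : ℝ} (hC : ∀ k σ, ‖W k σ‖ ≤ C) {p : ℕ} (hp : 0 < p) {T' : ℝ}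
    (hper : ∀ (n : ℤ) (σ : ℝ), W (n + p) σ = W n (σ - T')) (hne : ∃ n σ, W n σ ≠ 0) :
    1 ≤ (bigLam ε₀ - (bigLam ε₀)⁻¹) * fluxConst α * C := by
  by_contra h
  push Not at h
  obtain ⟨n, σ, hnz⟩ := hne
  exact hnz (blockDSS_eq_zero_of_small_bound hε hW hc hC hp hper h n σ)

/-- **Every witness of the registered kill criteria is large.**  On a cancelling `R`-comparable table
(`m = 4`) at scale ratio `1+ε₀`, `0 < ε₀ ≤ 1`, a non-trivial uniformly bounded admissible eternal
solution with any covariant viscosity `ν̂ ≥ 0` that is discretely self-similar modulo a block of `p ≥ 1`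
shells has a shell value of norm `> 1/(896 ε₀)` (so `UniformBound W`, which the kill criteria also
carry, holds only with constants `> 1/(896 ε₀)`).
[cite: Tao2016AveragedNS, §4 (4.1)–(4.3), §6.1, §6.4; cell theorem] -/
theorem blockDSS_exists_large {ε₀ νh R : ℝ} {α : Fin 4 → Fin 4 → Fin 4 → ℤ × ℤ × ℤ → ℝ}
    {W : ℤ → ℝ → Em 4} (hε : 0 < ε₀) (hε1 : ε₀ ≤ 1) (hc : IsCancellingCoeff α)
    (hα : IsComparableCoeff R α) (hW : IsEternalVisc ε₀ νh α W)
    {p : ℕ} (hp : 0 < p) {T' : ℝ} (hper : ∀ (n : ℤ) (σ : ℝ), W (n + p) σ = W n (σ - T'))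
    (hne : ∃ n σ, W n σ ≠ 0) : ∃ (n : ℤ) (σ : ℝ), 1 / (896 * ε₀) < ‖W n σ‖ := by
  by_contra h
  push Not at h
  have h1 := blockDSS_one_le_of_ne_zero hε hW hc h hp hper hne
  have h14 := WakeRatchetDSSAmplitudeFloor.bigLam_sub_inv_lt hε hε1
  have h64 := WakeRatchetDSSAmplitudeFloor.fluxConst_le_64 hα
  have hf0 : 0 ≤ fluxConst α := (table_sTable α hc).CA_nonneg
  have hq : 0 < 1 / (896 * ε₀) := by positivity
  have hlt : |bigLam ε₀ - (bigLam ε₀)⁻¹| * fluxConst α * (1 / (896 * ε₀)) < 1 := by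
    calc |bigLam ε₀ - (bigLam ε₀)⁻¹| * fluxConst α * (1 / (896 * ε₀))
        ≤ |bigLam ε₀ - (bigLam ε₀)⁻¹| * 64 * (1 / (896 * ε₀)) :=
          mul_le_mul_of_nonneg_right (mul_le_mul_of_nonneg_left h64 (abs_nonneg _)) hq.le
      _ < 14 * ε₀ * 64 * (1 / (896 * ε₀)) :=
          mul_lt_mul_of_pos_right (mul_lt_mul_of_pos_right h14 (by norm_num)) hq
      _ = 1 := by field_simp; ring
  have hle : (bigLam ε₀ - (bigLam ε₀)⁻¹) * fluxConst α * (1 / (896 * ε₀))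
      ≤ |bigLam ε₀ - (bigLam ε₀)⁻¹| * fluxConst α * (1 / (896 * ε₀)) :=
    mul_le_mul_of_nonneg_right (mul_le_mul_of_nonneg_right (le_abs_self _) hf0) hq.le
  linarith

end WakeRatchetBlockDSSFloor

end Summit.NavierStokesRegularity.NavierStokesRegularity.Theorems

end
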